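import Literature.NumberTheory.EllipticCurves.CyclotomicTorsionFrobeniusSign
import HarnessLib

/-!
# Certified chord-tangent steps with explicit slope, existential form

Topic `Literature/NumberTheory/EllipticCurves`, namespace `Literature.NumberTheory.EllipticCurves.CyclotomicTorsionSign` (sequel of
`CyclotomicTorsionFrobeniusSign`, §0 Tools).  THEOREMS ONLY.  The two group-law steps `add_self_of_slope` / `add_of_slope` of that
file take the nonsingularity of the result `(X, Y)` as an input; here it is an OUTPUT (Mathlib's `Affine.nonsingular_add`:
the chord-tangent sum of nonsingular points is nonsingular), so that an addition chain `P₁, 2P₁, 4P₁, …` built from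
`linear_combination` certificates needs «on the curve» only for `P₁` — used by the per-curve cyclotomic torsion certificates
(`GrossCurve19Torsion`, …) feeding `HasCyclotomicTorsionCert`.  Nothing about BSD is proved here.

## References
* J. H. Silverman, *The Arithmetic of Elliptic Curves*, 2nd ed. (2009), III.2.3 (group law algorithm). [SilvermanAEC2009]

## Mathlib / tree search
Tree: `CyclotomicTorsionSign.{add_self_of_slope, add_of_slope}`, `SqrtTwoTwist.EightTorsion.pt_eq`.
Mathlib: `WeierstrassCurve.Affine.{nonsingular_add, slope_of_Y_ne, slope_of_X_ne, addX, addY, negAddY, negY}`.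
-/

noncomputable section

open scoped Classical

namespace Literature.NumberTheory.EllipticCurves

namespace CyclotomicTorsionSign

open _root_.WeierstrassCurve

/-! ### Certified steps returning the nonsingularity of the result -/

section Steps

universe v

variable {F : Type v} [Field F] {V : WeierstrassCurve F}

/-- **Certified doubling, existential form**: under the hypotheses of `add_self_of_slope` minus the nonsingularity of `(X, Y)`,
which is OUTPUT (the sum of nonsingular points is nonsingular). [cite: SilvermanAEC2009, III.2.3 (duplication formula)] -/
theorem exists_add_self_of_slope {x y lam X Y : F} (hP : V.toAffine.Nonsingular x y) (hD : 2 * y + V.a₁ * x + V.a₃ ≠ 0)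
    (hlam : lam * (2 * y + V.a₁ * x + V.a₃) = 3 * x ^ 2 + 2 * V.a₂ * x + V.a₄ - V.a₁ * y)
    (hX : X = lam ^ 2 + V.a₁ * lam - V.a₂ - x - x) (hY : Y = -(lam * (X - x) + y) - V.a₁ * X - V.a₃) :
    ∃ hQ : V.toAffine.Nonsingular X Y, (Affine.Point.some x y hP : V.toAffine.Point) + .some x y hP = .some X Y hQ := by
  have hyne : y ≠ V.toAffine.negY x y := by
    rw [Affine.negY]; intro h; apply hD; linear_combination h
  have hs : V.toAffine.slope x x y y = lam := by
    rw [Affine.slope_of_Y_ne rfl hyne, show y - V.toAffine.negY x y = 2 * y + V.a₁ * x + V.a₃ by rw [Affine.negY]; ring,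
      div_eq_iff hD]
    exact hlam.symm
  have hQ' := Affine.nonsingular_add hP hP (fun hxy ↦ hyne hxy.right)
  have eX : V.toAffine.addX x x (V.toAffine.slope x x y y) = X := by rw [hs, Affine.addX, hX]
  have eY : V.toAffine.addY x x y (V.toAffine.slope x x y y) = Y := by
    rw [Affine.addY, Affine.negAddY, Affine.negY, eX, hs, hY]
  rw [eX, eY] at hQ'
  exact ⟨hQ', add_self_of_slope hP hQ' hD hlam hX hY⟩

/-- **Certified chord addition, existential form** (the nonsingularity of `(X, Y)` is output). [cite: SilvermanAEC2009, III.2.3 (group law algorithm)] -/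
theorem exists_add_of_slope {x₁ y₁ x₂ y₂ lam X Y : F} (h₁ : V.toAffine.Nonsingular x₁ y₁) (h₂ : V.toAffine.Nonsingular x₂ y₂)
    (hx : x₁ - x₂ ≠ 0) (hlam : lam * (x₁ - x₂) = y₁ - y₂)
    (hX : X = lam ^ 2 + V.a₁ * lam - V.a₂ - x₁ - x₂) (hY : Y = -(lam * (X - x₁) + y₁) - V.a₁ * X - V.a₃) :
    ∃ hQ : V.toAffine.Nonsingular X Y, (Affine.Point.some x₁ y₁ h₁ : V.toAffine.Point) + .some x₂ y₂ h₂ = .some X Y hQ := by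
  have hne : x₁ ≠ x₂ := fun h ↦ hx (by rw [h, sub_self])
  have hs : V.toAffine.slope x₁ x₂ y₁ y₂ = lam := by
    rw [Affine.slope_of_X_ne hne, div_eq_iff hx]; exact hlam.symm
  have hQ' := Affine.nonsingular_add h₁ h₂ (fun hxy ↦ hne hxy.left)
  have eX : V.toAffine.addX x₁ x₂ (V.toAffine.slope x₁ x₂ y₁ y₂) = X := by rw [hs, Affine.addX, hX]
  have eY : V.toAffine.addY x₁ x₂ y₁ (V.toAffine.slope x₁ x₂ y₁ y₂) = Y := by
    rw [Affine.addY, Affine.negAddY, Affine.negY, eX, hs, hY]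
  rw [eX, eY] at hQ'
  exact ⟨hQ', add_of_slope h₁ h₂ hQ' hx hlam hX hY⟩

end Steps

end CyclotomicTorsionSign

end Literature.NumberTheory.EllipticCurves

end
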